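import Summits.ValiantsHypothesis.ValiantsHypothesis.Theorems.FifoMatchingNNDivisionHardExactPencilScaledZgenCube
import HarnessLib

/-!
# EXACT PENCILS VII — the transversal-face TEMPLATE CEILING: interaction differences have NO common maximising vertex (the named obstruction, W6-P1) (crux `NNDivisionHard`, stmt-ValiantsHypothesis-21181) — `ExactPencil` port part 7/12

Theorems-side port (staged by val-idea-40 g6, C′-census owner per director-valiant R331 (2)(e) / desk #399, for the port hands;
press as `Theorems/FifoMatchingNNDivisionHardExactPencilInteractionCeiling.lean`, `--kind proof --supports stmt-ValiantsHypothesis-21181 --as helper`; sig-first val-idea-crit-9 g3) of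
§10 of val-idea-38 g2's crux workfile `Cruxes/NNDivisionHard/ExactPencil38.lean` REV 16 @4e81d1716f6b (sha16 d9f2e288279a0b09, 3 456 l., FROZEN — final from 38 g2, bus 01:14:51Z; critic of record val-idea-crit-9 g2/g3: `CRITIC-wave6.md` FINAL + V#97 §2 «rev 14/15 δ KERNEL VERIFIED»).  Declaration texts VERBATIM (namespace
`…Theorems.FifoMatching.ExactPencil`; one-line docstrings added where the source had none); the 40-g5 tools the source RESTATED are
DROPPED here and cited BY NAME from the landed ports `…Theorems.FifoMatching.LocatedRows.*` (✓ p680125 … p683387: `T`, `RowFamily`,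
`hCOR`, `exactTilted`, `ExactPencilLaw`, `pinnedRows`, `unflat`, `three_pow_le_of_block`, `two_pow_half_mul_le`, `zgen`, `cubePt`, …) and
`…Theorems.FifoMatching.XcDivision` (`udRow`, `udPt`, `udInd`, `udMat`, …), so that C′ stays ONE Theorems declaration
`LocatedRows.ExactPencilLaw`.  Part 7/12 of the port (imports part 6, `…Theorems.FifoMatchingNNDivisionHardExactPencilScaledZgenCube`).

* `LocatedRows.flat_sub'`, `inter` (interaction generator), `flat_dotProduct_inter`, `rep_insert_*`, `rep_singleton_*`, `rep_empty`, `transversal_read`, `alt_term`,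
  `transversal_mixed_diff`, `transversal_unread_inter(Diff)`, `udInd_map_ι₁/ι₂`, `udRow_map_dotProduct_inter(Diff)`, `interDiff_cw_neg/pos`,
  ★★ `no_common_argmax_of_interDiff`, ★★ `no_exact_column_of_interDiff` (CEILING: for ANY tilt tight on the transversals, no column is exact for both rows).

HONEST LABEL: every theorem here is a DECIDED SPECIES / support lemma for the OPEN law C′ = `LocatedRows.ExactPencilLaw`
(`exactTilted.Law`); the crux 21181 `NNDivisionHard`, C′, `allRows.Law` and COR-VIRTUAL are OPEN; C⁺_entry `LocatedPencilLaw` is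
REFUTED (✓ p679540).  VP ≠ VNP is NOT proved here or anywhere in this tree.
-/

set_option autoImplicit false

-- the mandated summit-side namespace repeats a component by design (single-problem summit)
set_option linter.dupNamespace false

noncomputable section

open Matrix Finset
open scoped Pointwise

namespace Summit.ValiantsHypothesis.ValiantsHypothesis.Theorems.FifoMatching.ExactPencil

open Literature.Barriers.PneNP (HasEFOfSize three_pow_le_card_mul_two_pow_of_cover_univ)
open Literature.Combinatorics.Optimization.FixedSizePsdRank
  (corPolytope flat vecOuter flat_dotProduct_le_of_mem_corPolytope flat_dotProduct_vecOuter)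
open Summit.ValiantsHypothesis.ValiantsHypothesis.Theorems.FifoMatching.XcDivision
  (udRow udPt udInd udMat ud_data udInd_apply udInd_sq dot_le_of_mem_convexHull flat_dotProduct_flat)
open Summit.ValiantsHypothesis.ValiantsHypothesis.Theorems.FifoMatching.LocatedRows
  (T CorVirtualHardN RowFamily corVirtualHardN_of_law flat_le_box entryTilted allRows LocatedPencilLaw
    hCOR le_hCOR exists_eq_hCOR flat_le_hCOR hCOR_le_box exactTilted ExactPencilLaw exactTilted_emb_allRows
    corVirtualHardN_of_exactPencilLaw three_pow_le_of_block two_pow_half_mul_le pinnedRows unflat flat_unflat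
    pinnedRows_emb_exactTilted corVirtualHardN_of_pinnedRowsLaw zgen cubePt dotProduct_cubePt)

/-! ## §10 The transversal-face TEMPLATE CEILING (the named obstruction, W6-P1): the interaction `I_{u,v}` of two pairs is a mixed second
difference of four transversals (`transversal_mixed_diff`), hence unread by every direction constant on the transversal face
(`transversal_unread_inter`); the interaction DIFFERENCE `I_{u,v} − I_{u,v'}` has clique weight `−2` on the block row `{u,v}` and `+2` on `{u,v'}`
(`interDiff_cw_neg/pos`), so no tilt tight on `F_π` has a common maximising vertex on a cube containing it (`no_common_argmax_of_interDiff`,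
`no_exact_column_of_interDiff`).  This named the candidate `Q_II` (memo §2e) — decided after all in §12. -/

section InteractionCeiling

variable {n : ℕ}

/-- the INTERACTION of the pairs `u, v`:
`I_{u,v} := zgen (ι₁u) (ι₁v) (ι₂v) − zgen (ι₂u) (ι₁v) (ι₂v) = E^s_{ι₁u ι₁v} − E^s_{ι₁u ι₂v} − E^s_{ι₂u ι₁v} + E^s_{ι₂u ι₂v}`. -/
def inter (u v : Fin (kk n)) : Matrix (Fin n) (Fin n) ℝ :=
  zgen (ι₁ u) (ι₁ v) (ι₂ v) - zgen (ι₂ u) (ι₁ v) (ι₂ v)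

/-- the read of a matrix `C` against the interaction generator `inter u v`, entrywise. -/
theorem flat_dotProduct_inter (C : Matrix (Fin n) (Fin n) ℝ) {u v : Fin (kk n)} (huv : u ≠ v) :
    flat C ⬝ᵥ flat (inter u v) =
      ((C (ι₁ u) (ι₁ v) + C (ι₁ v) (ι₁ u)) - (C (ι₁ u) (ι₂ v) + C (ι₂ v) (ι₁ u))) -
      ((C (ι₂ u) (ι₁ v) + C (ι₁ v) (ι₂ u)) - (C (ι₂ u) (ι₂ v) + C (ι₂ v) (ι₂ u))) := by
  unfold inter
  rw [LocatedRows.flat_sub', dotProduct_sub,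
    flat_dotProduct_zgen C (fun h => huv (ι₁_injective h)) (ι₁_ne_ι₂ u v),
    flat_dotProduct_zgen C (fun h => ι₁_ne_ι₂ v u h.symm) (fun h => huv (ι₂_injective h))]

/-! ### the four transversals `B_{uv}, B_{v}, B_{u}, B_∅` and their representatives -/

/-- `rep {u, v} u = ι₁ u`. -/
theorem rep_insert_left (u v : Fin (kk n)) : rep ({u, v} : Finset (Fin (kk n))) u = ι₁ u := by
  unfold rep; rw [if_pos (Finset.mem_insert_self u {v})]

/-- `rep {u, v} v = ι₁ v`. -/
theorem rep_insert_right (u v : Fin (kk n)) : rep ({u, v} : Finset (Fin (kk n))) v = ι₁ v := by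
  unfold rep; rw [if_pos (Finset.mem_insert_of_mem (Finset.mem_singleton_self v))]

/-- `rep {u, v} w = ι₂ w` for `w ∉ {u, v}`. -/
theorem rep_insert_other {u v w : Fin (kk n)} (h1 : w ≠ u) (h2 : w ≠ v) :
    rep ({u, v} : Finset (Fin (kk n))) w = ι₂ w := by
  unfold rep; rw [if_neg (by simp [h1, h2])]

/-- `rep {u} u = ι₁ u`. -/
theorem rep_singleton_self (u : Fin (kk n)) : rep ({u} : Finset (Fin (kk n))) u = ι₁ u := by
  unfold rep; rw [if_pos (Finset.mem_singleton_self u)]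

/-- `rep {u} w = ι₂ w` for `w ≠ u`. -/
theorem rep_singleton_other {u w : Fin (kk n)} (h : w ≠ u) : rep ({u} : Finset (Fin (kk n))) w = ι₂ w := by
  unfold rep; rw [if_neg (by simp [h])]

/-- `rep ∅ w = ι₂ w`. -/
theorem rep_empty (w : Fin (kk n)) : rep (∅ : Finset (Fin (kk n))) w = ι₂ w := by
  simp [rep]

/-- `⟨W, x_{B_T}⟩ = Σ_{u'} Σ_{v'} W (rep_T u') (rep_T v')`. -/
theorem transversal_read (W : Matrix (Fin n) (Fin n) ℝ) (T : Finset (Fin (kk n))) :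
    flat W ⬝ᵥ udPt (Bcol T) = ∑ u', ∑ v', W (rep T u') (rep T v') := by
  rw [flat_dotProduct_udPt_sum, sum_Bcol]
  exact Finset.sum_congr rfl fun u' _ => sum_Bcol (fun y => W (rep T u') y) T

/-- the termwise mixed difference over the four transversals: only the `(u,v)` and `(v,u)` terms survive. -/
theorem alt_term (W : Matrix (Fin n) (Fin n) ℝ) {u v : Fin (kk n)} (huv : u ≠ v) (u' v' : Fin (kk n)) :
    W (rep ({u, v} : Finset (Fin (kk n))) u') (rep ({u, v} : Finset (Fin (kk n))) v')
      - W (rep ({v} : Finset (Fin (kk n))) u') (rep ({v} : Finset (Fin (kk n))) v')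
      - W (rep ({u} : Finset (Fin (kk n))) u') (rep ({u} : Finset (Fin (kk n))) v')
      + W (rep (∅ : Finset (Fin (kk n))) u') (rep (∅ : Finset (Fin (kk n))) v') =
    (if u' = u ∧ v' = v then
        W (ι₁ u) (ι₁ v) - W (ι₂ u) (ι₁ v) - W (ι₁ u) (ι₂ v) + W (ι₂ u) (ι₂ v) else 0) +
      (if u' = v ∧ v' = u then
        W (ι₁ v) (ι₁ u) - W (ι₁ v) (ι₂ u) - W (ι₂ v) (ι₁ u) + W (ι₂ v) (ι₂ u) else 0) := by
  rcases eq_or_ne u' u with h1 | h1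
  · rcases eq_or_ne v' v with h2 | h2
    · rw [h1, h2, rep_insert_left, rep_insert_right, rep_singleton_other huv, rep_singleton_self v,
        rep_singleton_self u, rep_singleton_other huv.symm, rep_empty, rep_empty, if_pos ⟨rfl, rfl⟩,
        if_neg (fun h => huv h.1)]
      ring
    · rcases eq_or_ne v' u with h3 | h3
      · rw [h1, h3, rep_insert_left, rep_singleton_other huv, rep_singleton_self u, rep_empty,
          if_neg (fun h => huv h.2), if_neg (fun h => huv h.1)]
        ring
      · rw [h1, rep_insert_left, rep_insert_other h3 h2, rep_singleton_other huv, rep_singleton_other h2,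
          rep_singleton_self u, rep_singleton_other h3, rep_empty, rep_empty, if_neg (fun h => h2 h.2),
          if_neg (fun h => huv h.1)]
        ring
  · rcases eq_or_ne u' v with h3 | h3
    · rcases eq_or_ne v' u with h4 | h4
      · rw [h3, h4, rep_insert_right, rep_insert_left, rep_singleton_self v, rep_singleton_other huv,
          rep_singleton_other huv.symm, rep_singleton_self u, rep_empty, rep_empty,
          if_neg (fun h => huv.symm h.1), if_pos ⟨rfl, rfl⟩]
        ring
      · rcases eq_or_ne v' v with h5 | h5
        · rw [h3, h5, rep_insert_right, rep_singleton_self v, rep_singleton_other huv.symm, rep_empty,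
            if_neg (fun h => huv.symm h.1), if_neg (fun h => huv.symm h.2)]
          ring
        · rw [h3, rep_insert_right, rep_insert_other h4 h5, rep_singleton_self v, rep_singleton_other h5,
            rep_singleton_other huv.symm, rep_singleton_other h4, rep_empty, rep_empty,
            if_neg (fun h => huv.symm h.1), if_neg (fun h => h4 h.2)]
          ring
    · rw [rep_insert_other h1 h3, rep_singleton_other h3, rep_singleton_other h1, rep_empty u',
        if_neg (fun h => h1 h.1), if_neg (fun h => h3 h.1)]
      rcases eq_or_ne v' u with h4 | h4
      · rw [h4, rep_insert_left, rep_singleton_other huv, rep_singleton_self u, rep_empty]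
        ring
      · rcases eq_or_ne v' v with h5 | h5
        · rw [h5, rep_insert_right, rep_singleton_self v, rep_singleton_other huv.symm, rep_empty]
          ring
        · rw [rep_insert_other h4 h5, rep_singleton_other h5, rep_singleton_other h4, rep_empty]
          ring

/-- a double sum of an indicator of one index pair is its value there. -/
theorem sum_sum_ite_and (c : ℝ) (j m : Fin (kk n)) :
    ∑ i : Fin (kk n), ∑ i' : Fin (kk n), (if i = j ∧ i' = m then c else 0) = c := by
  have h := sum_sum_ite_and_mul (n := kk n) (fun _ _ => (1 : ℝ)) c j m
  simp only [mul_one] at h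
  exact h

/-- ★ **MIXED SECOND DIFFERENCE OF FOUR TRANSVERSALS = THE INTERACTION READ**:
`⟨W, x_{B_{uv}}⟩ − ⟨W, x_{B_v}⟩ − ⟨W, x_{B_u}⟩ + ⟨W, x_{B_∅}⟩ = ⟨W, I_{u,v}⟩` — so `I_{u,v} ∈ dir(F_π)`. -/
theorem transversal_mixed_diff (W : Matrix (Fin n) (Fin n) ℝ) {u v : Fin (kk n)} (huv : u ≠ v) :
    flat W ⬝ᵥ udPt (Bcol ({u, v} : Finset (Fin (kk n)))) - flat W ⬝ᵥ udPt (Bcol ({v} : Finset (Fin (kk n))))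
      - flat W ⬝ᵥ udPt (Bcol ({u} : Finset (Fin (kk n)))) + flat W ⬝ᵥ udPt (Bcol (∅ : Finset (Fin (kk n))))
      = flat W ⬝ᵥ flat (inter u v) := by
  rw [transversal_read, transversal_read, transversal_read, transversal_read, ← Finset.sum_sub_distrib,
    ← Finset.sum_sub_distrib, ← Finset.sum_add_distrib]
  simp_rw [← Finset.sum_sub_distrib, ← Finset.sum_add_distrib, alt_term W huv]
  simp_rw [Finset.sum_add_distrib]
  rw [sum_sum_ite_and, sum_sum_ite_and, flat_dotProduct_inter W huv]
  ring

/-- ★ **UNREAD**: a direction constant on the transversals reads zero on every interaction (any tilt exposing `F_π`). -/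
theorem transversal_unread_inter (W : Matrix (Fin n) (Fin n) ℝ) {u v : Fin (kk n)} (huv : u ≠ v)
    (hW : ∀ S : Finset (Fin (kk n)), flat W ⬝ᵥ udPt (Bcol S) = flat W ⬝ᵥ udPt (Bcol ∅)) :
    flat W ⬝ᵥ flat (inter u v) = 0 := by
  rw [← transversal_mixed_diff W huv, hW ({u, v} : Finset (Fin (kk n))), hW ({v} : Finset (Fin (kk n))),
    hW ({u} : Finset (Fin (kk n)))]
  ring

/-- in particular every EXACT located direction tight on the transversal face is blind to interaction differences. -/
theorem transversal_unread_interDiff (W : Matrix (Fin n) (Fin n) ℝ) {u v v' : Fin (kk n)} (huv : u ≠ v) (huv' : u ≠ v')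
    (hW : ∀ S : Finset (Fin (kk n)), flat W ⬝ᵥ udPt (Bcol S) = hCOR W) :
    flat W ⬝ᵥ flat (inter u v - inter u v') = 0 := by
  have h0 : ∀ S : Finset (Fin (kk n)), flat W ⬝ᵥ udPt (Bcol S) = flat W ⬝ᵥ udPt (Bcol ∅) := fun S => by rw [hW, hW]
  rw [LocatedRows.flat_sub', dotProduct_sub, transversal_unread_inter W huv h0, transversal_unread_inter W huv' h0, sub_zero]

/-! ### clique weights of interactions on the one-sided block rows: BOTH SIGNS -/

/-- `𝟙_{ι₁(a')}(ι₁ w) = [w ∈ a']`. -/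
theorem udInd_map_ι₁ (a' : Finset (Fin (kk n))) (w : Fin (kk n)) :
    udInd (a'.map (ι₁e n)) (ι₁ w) = if w ∈ a' then 1 else 0 := by
  rw [udInd_apply]
  by_cases h : w ∈ a'
  · rw [if_pos (show ι₁ w ∈ a'.map (ι₁e n) from Finset.mem_map.mpr ⟨w, h, rfl⟩), if_pos h]
  · rw [if_neg (fun hm => ?_), if_neg h]
    obtain ⟨w', hw', he⟩ := Finset.mem_map.mp hm
    have hww : w' = w := ι₁_injective he
    exact h (hww ▸ hw')

/-- `𝟙_{ι₁(a')}(ι₂ w) = 0`. -/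
theorem udInd_map_ι₂ (a' : Finset (Fin (kk n))) (w : Fin (kk n)) : udInd (a'.map (ι₁e n)) (ι₂ w) = 0 := by
  rw [udInd_apply, if_neg]
  intro hm
  obtain ⟨w', -, he⟩ := Finset.mem_map.mp hm
  exact ι₁_ne_ι₂ w' w he

/-- `⟨udRow ι₁(α'), I_{u,v}⟩ = −2·[u ∈ α']·[v ∈ α']`. -/
theorem udRow_map_dotProduct_inter (a' : Finset (Fin (kk n))) {u v : Fin (kk n)} (huv : u ≠ v) :
    udRow (a'.map (ι₁e n)) ⬝ᵥ flat (inter u v) =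
      -2 * (if u ∈ a' then (1 : ℝ) else 0) * (if v ∈ a' then (1 : ℝ) else 0) := by
  unfold inter
  rw [LocatedRows.flat_sub', dotProduct_sub,
    udRow_dotProduct_zgen _ (fun h => huv (ι₁_injective h)) (ι₁_ne_ι₂ u v),
    udRow_dotProduct_zgen _ (fun h => ι₁_ne_ι₂ v u h.symm) (fun h => huv (ι₂_injective h)),
    udInd_map_ι₁, udInd_map_ι₁, udInd_map_ι₂, udInd_map_ι₂]
  ring

/-- ★ `⟨udRow ι₁(α'), I_{u,v} − I_{u,v'}⟩ = −2·[u ∈ α']·([v ∈ α'] − [v' ∈ α'])` — SIGN-INDEFINITE across block rows. -/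
theorem udRow_map_dotProduct_interDiff (a' : Finset (Fin (kk n))) {u v v' : Fin (kk n)} (huv : u ≠ v) (huv' : u ≠ v') :
    udRow (a'.map (ι₁e n)) ⬝ᵥ flat (inter u v - inter u v') =
      -2 * (if u ∈ a' then (1 : ℝ) else 0) * ((if v ∈ a' then (1 : ℝ) else 0) - (if v' ∈ a' then (1 : ℝ) else 0)) := by
  rw [LocatedRows.flat_sub', dotProduct_sub, udRow_map_dotProduct_inter a' huv, udRow_map_dotProduct_inter a' huv']
  ring

/-- the clique weight of the interaction difference on the row `ι₁{u, v}` is `−2`. -/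
theorem interDiff_cw_neg {u v v' : Fin (kk n)} (huv : u ≠ v) (huv' : u ≠ v') (hvv' : v ≠ v') :
    udRow (({u, v} : Finset (Fin (kk n))).map (ι₁e n)) ⬝ᵥ flat (inter u v - inter u v') = -2 := by
  rw [udRow_map_dotProduct_interDiff _ huv huv', if_pos (Finset.mem_insert_self u _),
    if_pos (Finset.mem_insert_of_mem (Finset.mem_singleton_self v)),
    if_neg (by simp [huv'.symm, hvv'.symm] : v' ∉ ({u, v} : Finset (Fin (kk n))))]
  norm_num

/-- the clique weight of the interaction difference on the row `ι₁{u, v'}` is `+2`. -/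
theorem interDiff_cw_pos {u v v' : Fin (kk n)} (huv : u ≠ v) (huv' : u ≠ v') (hvv' : v ≠ v') :
    udRow (({u, v'} : Finset (Fin (kk n))).map (ι₁e n)) ⬝ᵥ flat (inter u v - inter u v') = 2 := by
  rw [udRow_map_dotProduct_interDiff _ huv huv', if_pos (Finset.mem_insert_self u _),
    if_neg (by simp [huv.symm, hvv'] : v ∉ ({u, v'} : Finset (Fin (kk n)))),
    if_pos (Finset.mem_insert_of_mem (Finset.mem_singleton_self v'))]
  norm_num

/-! ### ★★ the ceiling: no common maximising vertex for the two rows, for ANY tilt tight on the transversals -/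

/-- ★★ **TRANSVERSAL-FACE TEMPLATE CEILING**: on a cube containing the interaction difference, no tilt tight on the transversals has a
common maximising vertex for the two block rows `{u,v}`, `{u,v'}`. -/
theorem no_common_argmax_of_interDiff {N : ℕ} (Q₀ : Matrix (Fin n) (Fin n) ℝ) (G : Fin N → Matrix (Fin n) (Fin n) ℝ)
    {u v v' : Fin (kk n)} (huv : u ≠ v) (huv' : u ≠ v') (hvv' : v ≠ v') {t₀ : Fin N}
    (ht₀ : G t₀ = inter u v - inter u v') (W : Matrix (Fin n) (Fin n) ℝ)
    (hW : ∀ S : Finset (Fin (kk n)), flat W ⬝ᵥ udPt (Bcol S) = hCOR W) :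
    ¬ ∃ P : Finset (Fin N),
      (∀ P', (udRow (({u, v} : Finset (Fin (kk n))).map (ι₁e n)) + flat W) ⬝ᵥ cubePt Q₀ G P' ≤
          (udRow (({u, v} : Finset (Fin (kk n))).map (ι₁e n)) + flat W) ⬝ᵥ cubePt Q₀ G P) ∧
      (∀ P', (udRow (({u, v'} : Finset (Fin (kk n))).map (ι₁e n)) + flat W) ⬝ᵥ cubePt Q₀ G P' ≤
          (udRow (({u, v'} : Finset (Fin (kk n))).map (ι₁e n)) + flat W) ⬝ᵥ cubePt Q₀ G P) := by
  classical
  rintro ⟨P, h1, h2⟩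
  have hs1 : (udRow (({u, v} : Finset (Fin (kk n))).map (ι₁e n)) + flat W) ⬝ᵥ flat (G t₀) = -2 := by
    rw [add_dotProduct, ht₀, interDiff_cw_neg huv huv' hvv', transversal_unread_interDiff W huv huv' hW, add_zero]
  have hs2 : (udRow (({u, v'} : Finset (Fin (kk n))).map (ι₁e n)) + flat W) ⬝ᵥ flat (G t₀) = 2 := by
    rw [add_dotProduct, ht₀, interDiff_cw_pos huv huv' hvv', transversal_unread_interDiff W huv huv' hW, add_zero]
  by_cases ht : t₀ ∈ P
  · have h := h1 (P.erase t₀)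
    rw [dotProduct_cubePt, dotProduct_cubePt, ← Finset.add_sum_erase P _ ht, hs1] at h
    linarith
  · have h := h2 (insert t₀ P)
    rw [dotProduct_cubePt, dotProduct_cubePt, Finset.sum_insert ht, hs2] at h
    linarith

/-- the same ceiling read in the law's currency: if a passenger column `j⋆` of a cube vertex family realises the row maxima `mm` of BOTH
rows `(ι₁{u,v}, W)` and `(ι₁{u,v'}, W)` (as the §9 block needs at every column of the UDISJ minor), contradiction. -/
theorem no_exact_column_of_interDiff {N K : ℕ} (Q₀ : Matrix (Fin n) (Fin n) ℝ) (G : Fin N → Matrix (Fin n) (Fin n) ℝ)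
    {u v v' : Fin (kk n)} (huv : u ≠ v) (huv' : u ≠ v') (hvv' : v ≠ v') {t₀ : Fin N}
    (ht₀ : G t₀ = inter u v - inter u v') (W : Matrix (Fin n) (Fin n) ℝ)
    (hW : ∀ S : Finset (Fin (kk n)), flat W ⬝ᵥ udPt (Bcol S) = hCOR W)
    (e : Fin (K + 1) → Finset (Fin N)) (he : Function.Surjective e) (j : Fin (K + 1)) :
    ¬ ((∀ j', (udRow (({u, v} : Finset (Fin (kk n))).map (ι₁e n)) + flat W) ⬝ᵥ (cubePt Q₀ G ∘ e) j' ≤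
          (udRow (({u, v} : Finset (Fin (kk n))).map (ι₁e n)) + flat W) ⬝ᵥ (cubePt Q₀ G ∘ e) j) ∧
       (∀ j', (udRow (({u, v'} : Finset (Fin (kk n))).map (ι₁e n)) + flat W) ⬝ᵥ (cubePt Q₀ G ∘ e) j' ≤
          (udRow (({u, v'} : Finset (Fin (kk n))).map (ι₁e n)) + flat W) ⬝ᵥ (cubePt Q₀ G ∘ e) j)) := by
  rintro ⟨h1, h2⟩
  refine no_common_argmax_of_interDiff Q₀ G huv huv' hvv' ht₀ W hW ⟨e j, fun P' => ?_, fun P' => ?_⟩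
  · obtain ⟨j', hj'⟩ := he P'
    have := h1 j'
    simp only [Function.comp, hj'] at this
    exact this
  · obtain ⟨j', hj'⟩ := he P'
    have := h2 j'
    simp only [Function.comp, hj'] at this
    exact this

end InteractionCeiling

end Summit.ValiantsHypothesis.ValiantsHypothesis.Theorems.FifoMatching.ExactPencil
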